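import Literature.AlgebraicGeometry.Resolution.WeightedCentreZKernel
import Literature.AlgebraicGeometry.Resolution.WeightedCentreWeightBoundedFlow
import Literature.AlgebraicGeometry.Resolution.WeightedCentreEigenLift
import HarnessLib

/-!
# The `Z`-kernel `𝒢` of the toy model, II: the flow `Φ_𝔇(σ^r)` inside `𝒢`, the case `2 ≤ r ≤ p − 1` of THEOREM B, and the
# deepest-level dispatch (engine 1's `W(f)` toy model, target T107 part 2 — an instrument, NOT a resolution theorem)

Continuation of `WeightedCentreZKernel` (T107 part 1).  THEOREM B of the cell's light-class chain (LF-MODEL-eng1-g45 §6.3; typed assembly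
T107 of CARVER-NOTES-eng1-g45 §3) says that the group `𝒢(N)` of `Z`-infinitesimal graded isotropies of a (P)-menu with a bottom light class is
trivial; its proof takes the deepest level `r` of the orbit group `H₀ = ⟨s_μ X₀⟩` of a putative `X₀ ≠ id` and refutes each case `r = p`,
`2 ≤ r ≤ p − 1`, `r = 1` by producing a tailed light flow (THEOREM 𝔉′, `TailedLightFlow.noTailedLightFlow`).  Part 1 typed the set-up, the
case `r = p` and the two terminal bridges.  This file types, on `S = k[ε][σ] = (MvPolynomial ι k)[X]`:

* `Φ_𝔇(aσ^r) := TruncatedFlow.flowEquiv 𝔇 … (C a * X ^ r)` (L3/W3, `WeightedCentreWeightBoundedFlow`) LIES IN `𝒢`'s ambient `Q`-stable group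
  `K = graded ⊓ baseFixing ⊓ 𝔄_1 ⊓ zKernel Z ⊓ fixSlots V` as soon as `𝔇` is triangular with data in `(ε_Z)` killing `ε_Z ∪ ε_V`
  (`flowEquiv_mem_baseFixing/_level/_graded/_zKernel/_fixSlots`; the ideal-theoretic input is `derivation_apply_mem_of_X`: a derivation
  with `𝔇(ε_j) ∈ I` for all `j` maps `k[ε]` into `I`), has level datum `π_r(Φ_𝔇(aσ^r)) = a·𝔇` (`proj_flowEquiv`) and transforms under
  the torus by `s_c Φ_𝔇(aσ^r) = Φ_𝔇(ac^rσ^r) ` and `Φ_𝔇(aσ^r)^N = Φ_𝔇(Naσ^r)` (`scaleConj_flowEquiv`, `flowEquiv_C_mul_X_pow_pow`), whence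
  the EXACT eigen-relation `s_{μ₀} Φ_𝔇(σ^r) = Φ_𝔇(σ^r)^{n₀}`, `n₀ ≡ μ₀^r` (`scaleConj_castUnit_flowEquiv`) — LF-MODEL §5 (Φ1)–(Φ3) inside `𝒢`;
* CASE `2 ≤ r ≤ p − 1` OF THEOREM B, complete (`false_of_mem_level_mid`): for `x ∈ 𝒢 ∩ 𝔄_r` with `π_r(x) ≠ 0`, an exact
  eigen-relation `s_{μ₀} x = x^{n₀}` for a generator `μ₀` of `𝔽_pˣ`, and `x` fixing `g`: `𝔇 := π_r(x)` read as a derivation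
  (`ZKernel.projDer`), `Φ := Φ_𝔇(σ^r) ∈ K ∩ 𝔄_r` has the same level datum, so `E = Φ⁻¹x ∈ K ∩ 𝔄_{r+1}`; the exact eigen-climb
  (`EigenLift.eigen_climb_exact`, levels `r + 1 ≤ m ≤ p` non-resonant for a generator since `r ≥ 2`, and `K ∩ 𝔄_{p+1} = {1}` by part 1's
  `levelIn_eq_bot`) gives `x = Φ`; hence `Φ_𝔇(σ^r)` fixes `g`, i.e. `g(T_{σ^r} ε) = g` (`TruncatedFlow.flowC_apply`), and part 1's bridge
  `false_of_expand_sigmaExp` exhibits the tailed light flow `(𝔇, 0)` of unit `r` — contradicting `NoTailedLightFlow p u w g`;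
* the DEEPEST-LEVEL DISPATCH (`orbitGroup`, `orbitGroup_le`, `exists_deepest`): for `X₀ ≠ 1` in `𝒢 ∩ Stab(g)` the orbit group
  `H₀ = ⟨s_ν X₀⟩ ≤ K ∩ Stab(g)` is `Q`-stable with `H₀ ∩ 𝔄_{p+1} = {1}`, so it has a deepest level `1 ≤ r ≤ p` carrying some `x ≠ 1` with
  `π_r(x) ≠ 0` and EXACT eigen-relations `s_μ x = x^N` (`N ≡ μ^r`) for every `μ` (`EigenLift.exists_deepest_level`,
  `sConj_eq_pow_of_levelIn_succ_eq_bot`);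
* THEOREM B REDUCED TO ITS CASE `r = 1` (`eq_one_of_caseOne`): with the case `r = 1` stated as the claim `CaseOne` ("a `Z`-infinitesimal graded
  isotropy of `g` whose orbit group has no level-`2` part is trivial" — to be typed from L4 + `LevelReduction` + L8 + `FlowExtraction.eq_subst` by the
  next carver), `𝒢(N) ∩ Stab(g) = {1}` follows from the dispatch and the cases `r = p` (part 1) and `2 ≤ r ≤ p − 1` (here).

Everything is elementary commutative algebra over a commutative ring `k` (of characteristic `p` where the torus `Q = 𝔽_pˣ` enters); these are
instruments for the cell's toy model and NOT resolution theorems, NOT statements about the invariant of [AbramovichTemkinWlodarczyk2024] (whose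
§5.1, p. 1575, and Thm. 5.3.1 (2)–(3), p. 1578, are where weighted centres and their graded coordinate presentations come from).  The algebra is
textbook: automorphism groups, conjugation, congruence filtrations [Lang2002, Ch. I §3, Ch. IV §1, Ch. V §5]; truncated exponentials of derivations /
Hasse–Schmidt iterativity [Matsumura1987, §25, §27 (pp. 207–209)]; substitution groups `σ ↦ cσ` [SerreLocalFields1979, Ch. II §4 Lemma 1].
-/

namespace Literature.AlgebraicGeometry.Resolution.WeightedBlowup.ZKernel

open Polynomial OrderFiltration LevelProjection EigenLiftLevels EigenLift TruncatedFlow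

variable {k : Type*} [CommRing k] {ι : Type*}

/-! ## A derivation with data in an ideal maps into the ideal -/

/-- A `k`-derivation `𝔇` of `k[ε]` with `𝔇(ε_j) ∈ I` for every `j` maps `k[ε]` into the ideal `I` (Leibniz rule; bookkeeping behind "`Φ_𝔇 ≡ id mod (ε_Z)`").
[cite: Matsumura1987, §25; Lang2002, Ch. II §1] -/
theorem derivation_apply_mem_of_X (D : Derivation k (MvPolynomial ι k) (MvPolynomial ι k)) (I : Ideal (MvPolynomial ι k))
    (hD : ∀ j, D (MvPolynomial.X j) ∈ I) (P : MvPolynomial ι k) : D P ∈ I := by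
  induction P using MvPolynomial.induction_on with
  | C c =>
    rw [← MvPolynomial.algebraMap_eq, D.map_algebraMap]
    exact I.zero_mem
  | add a b ha hb =>
    rw [map_add]
    exact I.add_mem ha hb
  | mul_X a j ha =>
    rw [D.leibniz, smul_eq_mul, smul_eq_mul]
    exact I.add_mem (I.mul_mem_left _ (hD j)) (I.mul_mem_left _ ha)

/-- … hence so do its positive iterates on the generators (bookkeeping). [cite: Matsumura1987, §25] -/
theorem iterate_X_mem_of_X (D : Derivation k (MvPolynomial ι k) (MvPolynomial ι k)) (I : Ideal (MvPolynomial ι k))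
    (hD : ∀ j, D (MvPolynomial.X j) ∈ I) (i : ι) {n : ℕ} (hn : n ≠ 0) : D^[n] (MvPolynomial.X i) ∈ I := by
  obtain ⟨m, rfl⟩ := Nat.exists_eq_succ_of_ne_zero hn
  rw [Function.iterate_succ_apply']
  exact derivation_apply_mem_of_X D I hD _

/-! ## `Φ_𝔇(aσ^r)` inside the ambient group of `𝒢` -/

section Flow

variable {p : ℕ} {u : ℕ → k} {w : ι → ℚ} {r : ℕ} {D : Derivation k (MvPolynomial ι k) (MvPolynomial ι k)}
  (hu : ∀ n < p, (Nat.factorial n : k) * u n = 1) (hp : 1 ≤ p) (hw : ∀ j, 0 ≤ w j) (hθ : (0 : ℚ) ≤ r)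
  (hD : ∀ (a : MvPolynomial ι k) (m : ℚ), MvPolynomial.IsWeightedHomogeneous w a m →
    MvPolynomial.IsWeightedHomogeneous w (D a) (m - r))
  (hgen : ∀ i, w i < p • (r : ℚ) ∨ D (MvPolynomial.X i) = 0)
include hu hp hw hθ hD hgen

/-- `Φ_𝔇(τ)` is a `k[σ]`-automorphism: it fixes `σ` and the scalars ((Φ1); bookkeeping). [cite: Matsumura1987, §27 (pp. 207–209)] -/
theorem flowEquiv_mem_baseFixing (τ : k[X]) : flowEquiv D p u hu hp hw hθ hD hgen τ ∈ baseFixing :=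
  mem_baseFixing.mpr ⟨by rw [flowEquiv_apply, flow_X], fun c => by rw [flowEquiv_apply, flow_C_C]⟩

/-- `σ^m ∣ τ`, `m ≤ p` ⇒ `Φ_𝔇(τ) ∈ 𝔄_m` ((Φ1) "`≡ id mod σ^r`"; bookkeeping over `TruncatedFlow.X_pow_dvd_flow_sub_self`). [cite: Matsumura1987, §27 (pp. 207–209); Lang2002, Ch. IV §1] -/
theorem flowEquiv_mem_level {m : ℕ} (hm : m ≤ p) {τ : k[X]} (hτ : X ^ m ∣ τ) :
    flowEquiv D p u hu hp hw hθ hD hgen τ ∈ level (X : (MvPolynomial ι k)[X]) m :=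
  mem_level_of_slots m (flowEquiv_mem_baseFixing hu hp hw hθ hD hgen τ) fun _ => by
    rw [flowEquiv_apply]
    exact X_pow_dvd_flow_sub_self D p u hu hm hτ _

/-- `Φ_𝔇(aσ^r)`, `1 ≤ r`, is a GRADED `k[σ]`-automorphism for `deg 𝔇 = −r`, `wt σ = 1` ((Φ1) "graded"; bookkeeping over `isGradedHom_flow_C_mul_X_pow` and
`mem_graded_of_unipotent`). [cite: AbramovichTemkinWlodarczyk2024, Thm. 5.3.1 (2)–(3) (p. 1578); Matsumura1987, §27 (pp. 207–209)] -/
theorem flowEquiv_mem_graded (hr : 1 ≤ r) (a : k) : flowEquiv D p u hu hp hw hθ hD hgen (C a * X ^ r) ∈ graded w (1 : ℚ) := by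
  have hD' : ∀ (b : MvPolynomial ι k) (m : ℚ), MvPolynomial.IsWeightedHomogeneous w b m →
      MvPolynomial.IsWeightedHomogeneous w (D b) (m - r • (1 : ℚ)) := fun b m hb => by
    rw [nsmul_one]
    exact hD b m hb
  have hG : IsGradedHom w (1 : ℚ)
      (flowEquiv D p u hu hp hw hθ hD hgen (C a * X ^ r) : (MvPolynomial ι k)[X] →+* (MvPolynomial ι k)[X]) := by
    rw [toRingHom_flowEquiv]
    exact isGradedHom_flow_C_mul_X_pow D p u hD' a
  have hX1 : X ^ 1 ∣ C a * X ^ r := by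
    rw [pow_one]
    exact dvd_mul_of_dvd_right (dvd_pow_self X (by omega)) _
  exact mem_graded_of_unipotent hG (by rw [flowEquiv_apply, flow_X])
    (fun i => by simpa only [pow_one, flowEquiv_apply] using X_pow_dvd_flow_sub_self D p u hu hp hX1 (C (MvPolynomial.X i))) hw one_pos

/-- **`π_r(Φ_𝔇(aσ^r)) = a·𝔇`** for `1 ≤ r < p` ((Φ1); bookkeeping over `coeff_flowC_C_mul_X_pow`). [cite: Matsumura1987, §27 (pp. 207–209)] -/
theorem proj_flowEquiv (hr : 1 ≤ r) (hrp : r < p) (a : k) (i : ι) :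
    proj r (flowEquiv D p u hu hp hw hθ hD hgen (C a * X ^ r)) i = a • D (MvPolynomial.X i) := by
  rw [proj_apply, flowEquiv_apply, flow_C, coeff_sub, coeff_flowC_C_mul_X_pow D p u hu hr hrp a, coeff_C, if_neg (by omega), sub_zero]

/-- **`Φ_𝔇(τ) ∈ zKernel Z`** when the data `𝔇(ε_j)` lie in `(ε_Z)` and `𝔇(ε_Z) = 0`: `Φ_𝔇 ε_i − ε_i = Σ_{1≤n<p} u_n 𝔇^n(ε_i) ⟪τ⟫^n ∈ (ε_Z)` (LF-MODEL-eng1-g45 §6.3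
"`Φ ≡ id mod (ε_Z)`"; instrument, NOT a resolution theorem). [cite: Matsumura1987, §27 (pp. 207–209); Lang2002, Ch. II §1] -/
theorem flowEquiv_mem_zKernel {Z : Set ι} (hDZ : ∀ j, D (MvPolynomial.X j) ∈ (Ideal.span (MvPolynomial.X '' Z) : Ideal (MvPolynomial ι k)))
    (hZ : ∀ z ∈ Z, D (MvPolynomial.X z) = 0) (τ : k[X]) : flowEquiv D p u hu hp hw hθ hD hgen τ ∈ zKernel Z := by
  refine mem_zKernel_of_slots (flowEquiv_mem_baseFixing hu hp hw hθ hD hgen τ) (fun z hz => ?_) (fun i => ?_)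
  · rw [flowEquiv_apply, flow_C_X_of_apply_eq_zero D p u hu hp (hZ z hz)]
  · rw [flowEquiv_apply, flow_C, flowC_X]
    obtain ⟨p', rfl⟩ : ∃ p', p = p' + 1 := ⟨p - 1, by omega⟩
    have hu0 : u 0 = 1 := by simpa using hu 0 (by omega)
    rw [Finset.sum_range_succ', hu0, one_smul, Function.iterate_zero_apply, pow_zero, mul_one, add_sub_cancel_right]
    refine Ideal.sum_mem _ fun n _ => Ideal.mul_mem_right _ _ ?_
    rw [MvPolynomial.smul_eq_C_mul, map_mul]
    exact Ideal.mul_mem_left _ _ (Ideal.mem_map_of_mem _ (iterate_X_mem_of_X D _ hDZ i (Nat.succ_ne_zero n)))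

/-- `Φ_𝔇(τ)` fixes `ε_V` when `𝔇(ε_V) = 0` (bookkeeping). [cite: Matsumura1987, §27 (pp. 207–209)] -/
theorem flowEquiv_mem_fixSlots {V : Set ι} (hV : ∀ v ∈ V, D (MvPolynomial.X v) = 0) (τ : k[X]) :
    flowEquiv D p u hu hp hw hθ hD hgen τ ∈ fixSlots V :=
  mem_fixSlots.mpr fun v hv => by rw [flowEquiv_apply, flow_C_X_of_apply_eq_zero D p u hu hp (hV v hv)]

/-- **(Φ2) in the group: `s_c Φ_𝔇(aσ^r) = Φ_𝔇(ac^rσ^r)`** (bookkeeping over `rescaleHom_flowEquiv_C_mul_X_pow`). [cite: SerreLocalFields1979, Ch. II §4 Lemma 1] -/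
theorem scaleConj_flowEquiv (c : kˣ) (a : k) :
    scaleConj c (flowEquiv D p u hu hp hw hθ hD hgen (C a * X ^ r)) = flowEquiv D p u hu hp hw hθ hD hgen (C (a * (c : k) ^ r) * X ^ r) := by
  have h := coe_scaleConj c (flowEquiv_mem_baseFixing hu hp hw hθ hD hgen (C a * X ^ r))
  rw [rescaleHom_flowEquiv_C_mul_X_pow, ← toRingHom_flowEquiv hu hp hw hθ hD hgen] at h
  exact RingEquiv.ext fun y => RingHom.congr_fun h y

/-- **(Φ3) in the group: `Φ_𝔇(aσ^r)^N = Φ_𝔇(Naσ^r)`** (bookkeeping over `flowEquiv_nsmul`). [cite: Matsumura1987, §27 (pp. 207–209)] -/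
theorem flowEquiv_C_mul_X_pow_pow (N : ℕ) (a : k) :
    flowEquiv D p u hu hp hw hθ hD hgen (C a * X ^ r) ^ N = flowEquiv D p u hu hp hw hθ hD hgen (C ((N : k) * a) * X ^ r) := by
  rw [← flowEquiv_nsmul hu hp hw hθ hD hgen N, nsmul_eq_mul, ← mul_assoc, ← map_natCast (C : k →+* k[X]) N, ← map_mul]

/-- **The EXACT eigen-relation of `Φ_𝔇(σ^r)` under the torus**: `s_{μ₀} Φ_𝔇(σ^r) = Φ_𝔇(σ^r)^{n₀}` for `n₀ ≡ μ₀^r (mod p)` (LF-MODEL-eng1-g45 §5 (Φ2)+(Φ3): "`Φ` is an EXACT eigen-solution";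
instrument, NOT a resolution theorem). [cite: SerreLocalFields1979, Ch. II §4 Lemma 1; Lang2002, Ch. V §5] -/
theorem scaleConj_castUnit_flowEquiv [Fact p.Prime] [CharP k p] {μ₀ : (ZMod p)ˣ} {n₀ : ℕ} (hn₀ : (n₀ : ZMod p) = (μ₀ : ZMod p) ^ r) :
    scaleConj (castUnit p μ₀) (flowEquiv D p u hu hp hw hθ hD hgen (C 1 * X ^ r))
      = flowEquiv D p u hu hp hw hθ hD hgen (C 1 * X ^ r) ^ n₀ := by
  rw [scaleConj_flowEquiv, flowEquiv_C_mul_X_pow_pow, one_mul, mul_one, val_castUnit_pow, natCast_eq_castHom p hn₀]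

end Flow

/-! ## CASE `2 ≤ r ≤ p − 1` OF THEOREM B -/

section Mid

variable {w : ι → ℚ} {Z : Set ι} {ζ : ℚ} {p : ℕ} [Fact p.Prime] [CharP k p] {u : ℕ → k} {g : MvPolynomial ι k}

/-- **CASE `2 ≤ r ≤ p − 1` OF THEOREM B** (LF-MODEL-eng1-g45 §6.3, RE-DERIVATION-eng1-g44 §3.5): in the setting (non-negative slot weights, bottom class `Z` of weight `≥ ζ > 0`
and `< p`, the slots of weight `> p + 1` FIXED), let `x` be a graded `k[σ]`-automorphism `≡ id (mod σ)`, `Z`-infinitesimal (`x ∈ zKernel Z`), fixing `g`, lying in `𝔄_r` with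
`π_r(x) ≠ 0`, `2 ≤ r ≤ p − 1`, and satisfying the EXACT eigen-relation `s_{μ₀} x = x^{n₀}` for a generator `μ₀` of `𝔽_pˣ` and `n₀ ≡ μ₀^r`.  Then `𝔇 := π_r(x)` read as a derivation is
triangular (`ZKernel.vars_projDer`), `Φ := Φ_𝔇(σ^r) ∈ K ∩ 𝔄_r` (`K = graded ⊓ baseFixing ⊓ 𝔄_1 ⊓ zKernel Z ⊓ fixSlots V`) has `π_r(Φ) = 𝔇 = π_r(x)`, the exact eigen-climb
in the `Q`-stable group `K` (`EigenLift.eigen_climb_exact`; `K ∩ 𝔄_{p+1} = {1}` by `levelIn_eq_bot`; no level `r + 1 ≤ m ≤ p` is resonant for a generator) gives `x = Φ`, so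
`Φ_𝔇(σ^r)` fixes `g` and `(𝔇, 0)` is a tailed light flow of unit `r` on `(N, g)` (`false_of_expand_sigmaExp`) — contradicting `NoTailedLightFlow p u w g` (THEOREM 𝔉′).
Instrument for engine 1's `W(f)` toy model, NOT a resolution theorem. [cite: Lang2002, Ch. I §3, Ch. IV §1, Ch. V §5; Matsumura1987, §27 (pp. 207–209); AbramovichTemkinWlodarczyk2024, §5.1 (p. 1575)] -/
theorem false_of_mem_level_mid (hu : ∀ n < p, (Nat.factorial n : k) * u n = 1) (hw : ∀ i, 0 ≤ w i) (hZ : ∀ z ∈ Z, ζ ≤ w z) (hζ : 0 < ζ)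
    (hZp : ∀ z ∈ Z, w z < p) {x : (MvPolynomial ι k)[X] ≃+* (MvPolynomial ι k)[X]} (hxg : x ∈ graded w (1 : ℚ)) (hxb : x ∈ baseFixing)
    (hxk : x ∈ zKernel Z) (hxV : ∀ i, (p : ℚ) + 1 < w i → x (C (MvPolynomial.X i)) = C (MvPolynomial.X i)) {r : ℕ} (hr2 : 2 ≤ r)
    (hrp : r ≤ p - 1) (hl : x ∈ level (X : (MvPolynomial ι k)[X]) r) (hx0 : ∃ i, proj r x i ≠ 0) {μ₀ : (ZMod p)ˣ}
    (hμ₀ : orderOf μ₀ = p - 1) {n₀ : ℕ} (hn₀ : (n₀ : ZMod p) = (μ₀ : ZMod p) ^ r) (hsx : scaleConj (castUnit p μ₀) x = x ^ n₀)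
    (hg : x (C g) = C g) (hN : TailedLightFlow.NoTailedLightFlow p u w g) : False := by
  have hp2 : 2 ≤ p := (Fact.out : p.Prime).two_le
  have hp1 : 1 ≤ p := by omega
  have hr1 : 1 ≤ r := by omega
  have hrp' : r < p := by omega
  have hxg1 : IsGradedHom w (1 : ℚ) (x : (MvPolynomial ι k)[X] →+* (MvPolynomial ι k)[X]) := hxg.1
  -- `𝔇 := π_r(x)` read as a derivation, and its shape
  set D := projDer r x with hDdef
  have hDX : ∀ i, MvPolynomial.IsWeightedHomogeneous w (D (MvPolynomial.X i)) (w i - r) := fun i =>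
    isWeightedHomogeneous_projDer hxg1 r i
  have hD : ∀ (a : MvPolynomial ι k) (m : ℚ), MvPolynomial.IsWeightedHomogeneous w a m →
      MvPolynomial.IsWeightedHomogeneous w (D a) (m - r) := fun a m ha => TailedLightFlow.lowers_of_X D hDX ha
  have hθ : (0 : ℚ) ≤ r := Nat.cast_nonneg r
  have hgen : ∀ i, w i < p • (r : ℚ) ∨ D (MvPolynomial.X i) = 0 := fun i => by
    rcases le_or_gt (w i) ((p : ℚ) + 1) with hi | hi
    · left
      rw [nsmul_eq_mul]
      have h2r : (2 : ℚ) ≤ r := by exact_mod_cast hr2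
      have h2p : (2 : ℚ) ≤ p := by exact_mod_cast hp2
      nlinarith
    · exact Or.inr (projDer_X_of_V hxV r i hi)
  -- `Φ := Φ_𝔇(σ^r)` and the ambient `Q`-stable group `K`
  set Φ := flowEquiv D p u hu hp1 hw hθ hD hgen (C 1 * X ^ r) with hΦdef
  set V : Set ι := {i | (p : ℚ) + 1 < w i} with hVdef
  set K : Subgroup ((MvPolynomial ι k)[X] ≃+* (MvPolynomial ι k)[X]) :=
    graded w (1 : ℚ) ⊓ baseFixing ⊓ level (X : (MvPolynomial ι k)[X]) 1 ⊓ zKernel Z ⊓ fixSlots V with hKdef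
  have hQ : ∀ μ : (ZMod p)ˣ, ∀ A ∈ K, scaleConj (castUnit p μ) A ∈ K := fun μ A hA =>
    ⟨⟨⟨⟨scaleConj_mem_graded _ hA.1.1.1.2 hA.1.1.1.1, scaleConj_mem_baseFixing _ hA.1.1.1.2⟩,
      scaleConj_mem_level _ hA.1.1.1.2 hA.1.1.2⟩, scaleConj_mem_zKernel _ hA.1.2⟩, scaleConj_mem_fixSlots _ hA.2⟩
  have hK1 : K ≤ level (X : (MvPolynomial ι k)[X]) 1 := fun A hA => hA.1.1.2
  have hKb : K ≤ baseFixing := fun A hA => hA.1.1.1.2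
  have ht : levelIn (X : (MvPolynomial ι k)[X]) K (p + 1) = ⊥ :=
    levelIn_eq_bot (H := K) hw hZ (fun A hA => hA.1.1.1.1) hKb (fun A hA => hA.1.2) (fun A hA => hA.2) fun i => by
      rcases le_or_gt (w i) ((p : ℚ) + 1) with hi | hi
      · left
        push_cast
        linarith
      · exact Or.inr hi
  -- memberships of `Φ` and `x`
  have hΦb : Φ ∈ baseFixing := flowEquiv_mem_baseFixing hu hp1 hw hθ hD hgen _
  have hΦr : Φ ∈ level (X : (MvPolynomial ι k)[X]) r := flowEquiv_mem_level hu hp1 hw hθ hD hgen hrp'.le (dvd_mul_left _ _)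
  have hΦ1 : Φ ∈ level (X : (MvPolynomial ι k)[X]) 1 := level_antitone _ hr1 hΦr
  have hΦg : Φ ∈ graded w (1 : ℚ) := flowEquiv_mem_graded hu hp1 hw hθ hD hgen hr1 1
  have hΦk : Φ ∈ zKernel Z :=
    flowEquiv_mem_zKernel hu hp1 hw hθ hD hgen (fun j => projDer_X_mem_span hxk r j) (fun z hz => projDer_X_of_mem hxk r hz) _
  have hΦV : Φ ∈ fixSlots V := flowEquiv_mem_fixSlots hu hp1 hw hθ hD hgen (fun v hv => projDer_X_of_V hxV r v hv) _
  have hΦK : Φ ∈ K := ⟨⟨⟨⟨hΦg, hΦb⟩, hΦ1⟩, hΦk⟩, hΦV⟩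
  have hx1 : x ∈ level (X : (MvPolynomial ι k)[X]) 1 := level_antitone _ hr1 hl
  have hxK : x ∈ K := ⟨⟨⟨⟨hxg, hxb⟩, hx1⟩, hxk⟩, mem_fixSlots.mpr fun i hi => hxV i hi⟩
  -- the exact eigen-climb in `K`
  have hres : ∀ m, r + 1 ≤ m → m < p + 1 → μ₀ ^ m ≠ μ₀ ^ r := fun m hm1 hm2 =>
    nonresonant_of_orderOf hμ₀ (by omega) (by omega)
  have hΦir : Φ⁻¹ ∈ level (X : (MvPolynomial ι k)[X]) r := (level _ r).inv_mem hΦr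
  have hE : (⟨Φ, hΦK⟩ : K)⁻¹ * ⟨x, hxK⟩ ∈ levelIn (X : (MvPolynomial ι k)[X]) K (r + 1) := by
    show Φ⁻¹ * x ∈ level (X : (MvPolynomial ι k)[X]) (r + 1)
    refine mem_level_succ_of_proj_eq_zero (mul_mem hΦir hl) (mul_mem (baseFixing.inv_mem hΦb) hxb) fun i => ?_
    rw [proj_mul hr1 hΦir hl, proj_inv hr1 hΦr, proj_flowEquiv hu hp1 hw hθ hD hgen hr1 hrp' 1 i, one_smul, hDdef, projDer_X,
      neg_add_cancel]
  have hh : (1 : K) ∈ levelIn (X : (MvPolynomial ι k)[X]) K (p + 1) := one_mem _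
  have hΦ : sConj K hQ μ₀ ⟨Φ, hΦK⟩ = ⟨Φ, hΦK⟩ ^ n₀ := Subtype.ext (by
    rw [coe_sConj, Subgroup.coe_pow]
    exact scaleConj_castUnit_flowEquiv hu hp1 hw hθ hD hgen hn₀)
  have hx : sConj K hQ μ₀ ⟨x, hxK⟩ = ⟨x, hxK⟩ ^ n₀ * 1 := Subtype.ext (by
    rw [mul_one, coe_sConj, Subgroup.coe_pow]
    exact hsx)
  have hclimb := eigen_climb_exact hK1 hKb hQ μ₀ n₀ hn₀ (by omega : r + 1 ≤ p + 1) hres ht hE hh hΦ hx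
  have hxΦ : x = Φ := congrArg Subtype.val hclimb
  -- `Φ_𝔇(σ^r)` fixes `g`: `g(T_{σ^r} ε) = g`
  have hfix : flowC D p u (C 1 * X ^ r) g = C g := by
    rw [← flow_C, ← flowEquiv_apply hu hp1 hw hθ hD hgen, ← hΦdef, ← hxΦ, hg]
  rw [flowC_apply, Polynomial.map_mul, Polynomial.map_C, MvPolynomial.C_1, map_one, one_mul, Polynomial.map_pow, Polynomial.map_X,
    aeval_X_pow_eq_expand] at hfix
  exact false_of_expand_sigmaExp hN (by omega) hDX (vars_projDer hw hZ hζ hZp hxg1 hxk hxV hr1)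
    (fun i hi => projDer_X_of_V hxV r i hi) (hx0.imp fun i hi => by rwa [hDdef, projDer_X]) hfix

end Mid

/-! ## The deepest-level dispatch and THEOREM B reduced to its case `r = 1` -/

section Dispatch

variable {w : ι → ℚ} {Z : Set ι} {ζ : ℚ} (p : ℕ) [Fact p.Prime] [CharP k p] {u : ℕ → k} {g : MvPolynomial ι k}

/-- The ORBIT GROUP `H₀ = ⟨s_ν X₀ : ν ∈ 𝔽_pˣ⟩` of `X₀` under the torus (construction; RE-DERIVATION-eng1-g43 §3.2, LF-MODEL-eng1-g45 §6.3). [cite: Lang2002, Ch. I §3, Ch. V §5] -/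
noncomputable def orbitGroup (X₀ : (MvPolynomial ι k)[X] ≃+* (MvPolynomial ι k)[X]) :
    Subgroup ((MvPolynomial ι k)[X] ≃+* (MvPolynomial ι k)[X]) :=
  Subgroup.closure (Set.range fun ν : (ZMod p)ˣ => scaleConj (castUnit p ν) X₀)

/-- `X₀ ∈ H₀` (bookkeeping). [cite: Lang2002, Ch. I §3] -/
theorem mem_orbitGroup_self (X₀ : (MvPolynomial ι k)[X] ≃+* (MvPolynomial ι k)[X]) : X₀ ∈ orbitGroup p X₀ := by
  refine Subgroup.subset_closure ⟨1, ?_⟩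
  show scaleConj (castUnit p 1) X₀ = X₀
  rw [map_one, map_one, MulAut.one_apply]

/-- `H₀` is `Q`-stable (bookkeeping over `EigenLift.scaleConj_mem_orbitClosure`). [cite: Lang2002, Ch. I §3] -/
theorem orbitGroup_stable (X₀ : (MvPolynomial ι k)[X] ≃+* (MvPolynomial ι k)[X]) :
    ∀ μ : (ZMod p)ˣ, ∀ A ∈ orbitGroup p X₀, scaleConj (castUnit p μ) A ∈ orbitGroup p X₀ := fun μ _ hA =>
  scaleConj_mem_orbitClosure X₀ μ hA

/-- **`H₀ ≤ 𝒢 ∩ Stab(g)`**: the orbit group of `X₀ ∈ graded ⊓ baseFixing ⊓ 𝔄_1 ⊓ zKernel Z ⊓ fixSlots V ⊓ Stab(C g)` stays there, all six being `Q`-stable (LF-MODEL-eng1-g45 (S4):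
"`𝒢` is `Q`-stable"; bookkeeping). [cite: Lang2002, Ch. I §3; SerreLocalFields1979, Ch. II §4 Lemma 1] -/
theorem orbitGroup_le {V : Set ι} {X₀ : (MvPolynomial ι k)[X] ≃+* (MvPolynomial ι k)[X]} (hg : X₀ ∈ graded w (1 : ℚ)) (hb : X₀ ∈ baseFixing)
    (h1 : X₀ ∈ level (X : (MvPolynomial ι k)[X]) 1) (hk : X₀ ∈ zKernel Z) (hV : X₀ ∈ fixSlots V) (hfix : X₀ (C g) = C g) :
    orbitGroup p X₀ ≤ graded w (1 : ℚ) ⊓ baseFixing ⊓ level (X : (MvPolynomial ι k)[X]) 1 ⊓ zKernel Z ⊓ fixSlots V ⊓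
      MulAction.stabilizer ((MvPolynomial ι k)[X] ≃+* (MvPolynomial ι k)[X]) (C g : (MvPolynomial ι k)[X]) := by
  refine orbitClosure_le X₀ hb _ (fun c A hA _ => ?_) ⟨⟨⟨⟨⟨hg, hb⟩, h1⟩, hk⟩, hV⟩, MulAction.mem_stabilizer_iff.mpr hfix⟩
  exact ⟨⟨⟨⟨⟨scaleConj_mem_graded _ hA.1.1.1.1.2 hA.1.1.1.1.1, scaleConj_mem_baseFixing _ hA.1.1.1.1.2⟩,
    scaleConj_mem_level _ hA.1.1.1.1.2 hA.1.1.1.2⟩, scaleConj_mem_zKernel _ hA.1.1.2⟩, scaleConj_mem_fixSlots _ hA.1.2⟩,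
    scaleConj_mem_stabilizer _ hA.2⟩

/-- **THE DEEPEST-LEVEL DISPATCH of THEOREM B** (LF-MODEL-eng1-g45 §6.3, first paragraph): in the setting (non-negative weights, bottom class `Z` of weight `≥ ζ > 0`, every slot of
weight `> p + 1` in `V`), for `X₀ ≠ 1` graded, `≡ id (mod σ)`, `Z`-infinitesimal, fixing `ε_V` and `g`, the orbit group `H₀ = ⟨s_ν X₀⟩` has `H₀ ∩ 𝔄_{p+1} = {1}` and a DEEPEST LEVEL
`1 ≤ r ≤ p` (`H₀ ∩ 𝔄_{r+1} = {1}`) carrying an `x ∈ H₀ ∩ 𝔄_r`, `x ≠ 1`, with `π_r(x) ≠ 0` and the EXACT eigen-relations `s_μ x = x^N` for every `μ ∈ 𝔽_pˣ`, `N ≡ μ^r`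
(`EigenLift.exists_deepest_level`, `sConj_eq_pow_of_levelIn_succ_eq_bot`, `eq_one_of_proj_eq_zero`).  Instrument for engine 1's `W(f)` toy model, NOT a resolution theorem.
[cite: Lang2002, Ch. I §§3, 6, Ch. IV §1, Ch. V §5; AbramovichTemkinWlodarczyk2024, §5.1 (p. 1575)] -/
theorem exists_deepest (hw : ∀ i, 0 ≤ w i) (hZ : ∀ z ∈ Z, ζ ≤ w z) (hζ : 0 < ζ) {V : Set ι} (hVw : ∀ i, w i ≤ (p : ℚ) + 1 ∨ i ∈ V)
    {X₀ : (MvPolynomial ι k)[X] ≃+* (MvPolynomial ι k)[X]} (hg : X₀ ∈ graded w (1 : ℚ)) (hb : X₀ ∈ baseFixing)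
    (h1 : X₀ ∈ level (X : (MvPolynomial ι k)[X]) 1) (hk : X₀ ∈ zKernel Z) (hV : X₀ ∈ fixSlots V) (hfix : X₀ (C g) = C g) (hne : X₀ ≠ 1) :
    ∃ r, 1 ≤ r ∧ r ≤ p ∧ levelIn (X : (MvPolynomial ι k)[X]) (orbitGroup p X₀) (r + 1) = ⊥ ∧
      ∃ x ∈ orbitGroup p X₀, x ∈ level (X : (MvPolynomial ι k)[X]) r ∧ x ≠ 1 ∧ (∃ i, proj r x i ≠ 0) ∧
        ∀ (μ : (ZMod p)ˣ) (N : ℕ), (N : ZMod p) = (μ : ZMod p) ^ r → scaleConj (castUnit p μ) x = x ^ N := by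
  have hle := orbitGroup_le p hg hb h1 hk hV hfix
  have hH1 : orbitGroup p X₀ ≤ level (X : (MvPolynomial ι k)[X]) 1 := fun A hA => (hle hA).1.1.1.2
  have hHb : orbitGroup p X₀ ≤ baseFixing := fun A hA => (hle hA).1.1.1.1.2
  have hbot : levelIn (X : (MvPolynomial ι k)[X]) (orbitGroup p X₀) (p + 1) = ⊥ :=
    levelIn_eq_bot (H := orbitGroup p X₀) hw hZ (fun A hA => (hle hA).1.1.1.1.1) hHb (fun A hA => (hle hA).1.1.2)
      (fun A hA => (hle hA).1.2) fun i => by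
      rcases hVw i with hi | hi
      · left
        push_cast
        linarith
      · exact Or.inr hi
  have hne' : ∃ x : orbitGroup p X₀, x ≠ 1 :=
    ⟨⟨X₀, mem_orbitGroup_self p X₀⟩, fun h => hne (congrArg Subtype.val h)⟩
  obtain ⟨r, hr1, hrp, hr, hr'⟩ := exists_deepest_level hH1 hbot hne'
  obtain ⟨x, hx, hx1⟩ : ∃ x ∈ levelIn (X : (MvPolynomial ι k)[X]) (orbitGroup p X₀) r, x ≠ 1 := by
    by_contra h
    push Not at h
    exact hr ((Subgroup.eq_bot_iff_forall _).mpr h)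
  refine ⟨r, hr1, by omega, hr', x, x.2, mem_levelIn.mp hx, fun h => hx1 (Subtype.ext h), ?_, fun μ N hN => ?_⟩
  · by_contra h0
    push Not at h0
    exact hx1 (eq_one_of_proj_eq_zero hHb hr' hx h0)
  · have h := congrArg Subtype.val (sConj_eq_pow_of_levelIn_succ_eq_bot hH1 hHb (orbitGroup_stable p X₀) hr' μ hN hx)
    simpa only [coe_sConj, Subgroup.coe_pow] using h

/-- **THE CLAIM OF CASE `r = 1` OF THEOREM B** (LF-MODEL-eng1-g45 §6.3, last case; NOT typed in this file — its proof runs L4 (`TruncatedFlow`) + `LevelReduction` + L8 +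
`FlowExtraction.eq_subst` + `ZKernel.false_of_apply_eq_substC` and is the next carver's target): in the setting of the menu `(p, u, w, Z, V, g)`, a graded `k[σ]`-automorphism
`X₀ ≡ id (mod σ)`, `Z`-infinitesimal, fixing `ε_V` and `g`, whose orbit group has NO level-`2` part (`H₀ ∩ 𝔄_2 = {1}`, i.e. deepest level `r = 1`) is the identity.
Instrument for engine 1's `W(f)` toy model, NOT a resolution theorem. [cite: Lang2002, Ch. IV §1; Matsumura1987, §27 (pp. 207–209)] -/
def CaseOne (w : ι → ℚ) (Z V : Set ι) (g : MvPolynomial ι k) : Prop :=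
  ∀ X₀ : (MvPolynomial ι k)[X] ≃+* (MvPolynomial ι k)[X], X₀ ∈ graded w (1 : ℚ) → X₀ ∈ baseFixing →
    X₀ ∈ level (X : (MvPolynomial ι k)[X]) 1 → X₀ ∈ zKernel Z → X₀ ∈ fixSlots V → X₀ (C g) = C g →
      levelIn (X : (MvPolynomial ι k)[X]) (orbitGroup p X₀) 2 = ⊥ → X₀ = 1

/-- **THEOREM B REDUCED TO ITS CASE `r = 1`** (LF-MODEL-eng1-g45 §6.3 "`𝒢(N) = {1}`", typed assembly T107 minus the case `r = 1`): in the setting — `char k = p`, `u_n n! = 1` (`n < p`),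
non-negative slot weights, bottom light class `Z` of weight in `[ζ, p)`, `ζ > 0`, `V ⊇` the slots of weight `> p + 1` and `V` of weight `> p + 1` — IF the case-`r = 1` claim `CaseOne` holds and
`(N, g)` carries no tailed light flow (THEOREM 𝔉′: `TailedLightFlow.noTailedLightFlow`), THEN every graded `k[σ]`-automorphism `X₀ ≡ id (mod σ)` that is `Z`-infinitesimal, fixes `ε_V`
and fixes `g` is the identity: `𝒢(N) ∩ Stab(g) = {1}`.  Proof: dispatch (`exists_deepest`) + case `r = p` (`false_of_mem_level_p`) + case `2 ≤ r ≤ p − 1` (`false_of_mem_level_mid`, with a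
generator `μ₀` of `𝔽_pˣ`, `EigenLift.exists_orderOf_eq`) + case `r = 1` (`CaseOne`, applied to `x ∈ H₀`: its orbit group lies in `H₀`).  Instrument for engine 1's `W(f)` toy model, NOT a
resolution theorem. [cite: Lang2002, Ch. I §§3, 6, Ch. IV §1, Ch. V §5; Matsumura1987, §27 (pp. 207–209); AbramovichTemkinWlodarczyk2024, §5.1 (p. 1575), Thm. 5.3.1 (2)–(3) (p. 1578)] -/
theorem eq_one_of_caseOne (hu : ∀ n < p, (Nat.factorial n : k) * u n = 1) (hw : ∀ i, 0 ≤ w i) (hZ : ∀ z ∈ Z, ζ ≤ w z) (hζ : 0 < ζ)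
    (hZp : ∀ z ∈ Z, w z < p) {V : Set ι} (hVw : ∀ i, w i ≤ (p : ℚ) + 1 ∨ i ∈ V) (hwV : ∀ i ∈ V, (p : ℚ) + 1 < w i)
    (hN : TailedLightFlow.NoTailedLightFlow p u w g) (hcase : CaseOne p w Z V g)
    {X₀ : (MvPolynomial ι k)[X] ≃+* (MvPolynomial ι k)[X]} (hg : X₀ ∈ graded w (1 : ℚ)) (hb : X₀ ∈ baseFixing)
    (h1 : X₀ ∈ level (X : (MvPolynomial ι k)[X]) 1) (hk : X₀ ∈ zKernel Z) (hV : X₀ ∈ fixSlots V) (hfix : X₀ (C g) = C g) : X₀ = 1 := by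
  by_contra hne
  have hp2 : 2 ≤ p := (Fact.out : p.Prime).two_le
  have hle := orbitGroup_le p hg hb h1 hk hV hfix
  obtain ⟨r, hr1, hrp, hbot, x, hxH, hxr, hx1, hx0, hexact⟩ := exists_deepest p hw hZ hζ hVw hg hb h1 hk hV hfix hne
  have hxg : x ∈ graded w (1 : ℚ) := (hle hxH).1.1.1.1.1
  have hxb : x ∈ baseFixing := (hle hxH).1.1.1.1.2
  have hxk : x ∈ zKernel Z := (hle hxH).1.1.2
  have hxV : x ∈ fixSlots V := (hle hxH).1.2
  have hxfix : x (C g) = C g := MulAction.mem_stabilizer_iff.mp (hle hxH).2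
  have hxV' : ∀ i, (p : ℚ) + 1 < w i → x (C (MvPolynomial.X i)) = C (MvPolynomial.X i) := fun i hi => by
    rcases hVw i with h | h
    · exact absurd hi (not_lt.mpr h)
    · exact hxV i h
  obtain ⟨μ₀, hμ₀⟩ := exists_orderOf_eq (p := p)
  rcases Nat.lt_or_ge r 2 with hr | hr
  · -- case `r = 1`
    obtain rfl : r = 1 := by omega
    have hsub : orbitGroup p x ≤ orbitGroup p X₀ :=
      (Subgroup.closure_le _).mpr (by rintro _ ⟨ν, rfl⟩; exact orbitGroup_stable p X₀ ν x hxH)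
    have hbot' : levelIn (X : (MvPolynomial ι k)[X]) (orbitGroup p x) 2 = ⊥ := by
      refine (Subgroup.eq_bot_iff_forall _).mpr fun y hy => ?_
      have hy' : (⟨(y : (MvPolynomial ι k)[X] ≃+* (MvPolynomial ι k)[X]), hsub y.2⟩ : orbitGroup p X₀) ∈
          levelIn (X : (MvPolynomial ι k)[X]) (orbitGroup p X₀) (1 + 1) := mem_levelIn.mpr (mem_levelIn.mp hy)
      rw [hbot, Subgroup.mem_bot, Subgroup.mk_eq_one] at hy'
      exact OneMemClass.coe_eq_one.mp hy'
    exact hx1 (hcase x hxg hxb (hle hxH).1.1.1.2 hxk hxV hxfix hbot')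
  rcases Nat.lt_or_ge r p with hrp' | hrp'
  · -- case `2 ≤ r ≤ p − 1`
    exact false_of_mem_level_mid hu hw hZ hζ hZp hxg hxb hxk hxV' hr (by omega) hxr hx0 hμ₀ (n₀ := (μ₀ : ZMod p).val ^ r)
      (by rw [Nat.cast_pow, ZMod.natCast_zmod_val]) (hexact μ₀ _ (by rw [Nat.cast_pow, ZMod.natCast_zmod_val])) hxfix hN
  · -- case `r = p`
    obtain rfl : r = p := by omega
    exact false_of_mem_level_p hu hp2 hw hZ hζ hxg hxb hxk hxV' hxr hx1 hxfix hN

end Dispatch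

end Literature.AlgebraicGeometry.Resolution.WeightedBlowup.ZKernel
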